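import Mathlib
import Summits.Ventures.HodgeRepro.Tier4.Target
import Summits.Ventures.HodgeRepro.Tier4.Common.AutForms
import Summits.Ventures.HodgeRepro.Tier4.Line3.KMDatum
import Summits.Ventures.HodgeRepro.Tier4.Line3.KMDatumS
import Summits.Ventures.HodgeRepro.Tier4.Line3.Defs
import Summits.Ventures.HodgeRepro.Tier4.Line3.CopyWeightGaussian
import Summits.Ventures.HodgeRepro.Tier4.Line3.HKRayReduction
import Summits.Ventures.HodgeRepro.Tier4.Line3.DatumOrthVanishing
import Summits.Ventures.HodgeRepro.Tier4.Line3.OriginRigidity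
import Summits.Ventures.HodgeRepro.Tier4.Line3.Transvection
import Summits.Ventures.HodgeRepro.Tier4.Line3.KMKernelForm
import Summits.Ventures.HodgeRepro.Tier4.Line3.KMDilation
import Summits.Ventures.HodgeRepro.Tier4.Line3.HeckeEquivarianceLemmas
import Summits.Ventures.HodgeRepro.Tier4.Line3.KernelIntegralPos
import Summits.Ventures.HodgeRepro.Tier4.Line3.SlotFunctionAlgebra
import Summits.Ventures.HodgeRepro.Tier4.Line3.ModelIntegrand
import Summits.Ventures.HodgeRepro.Tier4.Line3.ShapeIntegrandBounds
import Summits.Ventures.HodgeRepro.Tier4.Line3.ShapeIntegralBounds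
import Summits.Ventures.HodgeRepro.Tier4.Line3.DilationComparisonOfShape
import Summits.Ventures.HodgeRepro.Tier4.Line3.KMLaplace
import Summits.Ventures.HodgeRepro.Tier4.Line3.KMShapeGlue

/-!
# Tier4/Line3/KMLaplaceDischarge — x2's displayed Laplace bounds `KMLaplaceUpper` / `KMLaplaceLower` are theorems

Blind re-derivation cell `pub-hodge-repro`, Tier 4 «PROVE THE STEP» (README §9–§10), LINE L3, seat t4-L3-p1 (gen 3),
self-cut C-L3-DILCOMP (bus S14565, S14694, S14707), the companion of `Line3/KMShapeGlue`: on the ball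
`kmDilInt xm α β = shapeInt y₀ y₁ W_KM α β` (`kmDilInt_eq_shapeInt`), so the two-sided bounds of `ShapeIntegralBounds`
give, for every symmetric centre `xm` with `hab` and `hpos`, `∃ C ≥ 0, KMLaplaceUpper xm C 6` (`J(μ) = Φ(μ/2) ≤
16 A₁ μ⁻⁴ + 64 A₂ μ⁻⁶ ≤ 64 (A₁ + A₂)(μ⁻⁴ + μ⁻⁶)`, with the integrability clause from `integrableOn_shapeInt`) and
`∃ c > 0, KMLaplaceLower xm c` (`J(ν) = Φ(ν/2) ≥ Φ(ν) ≥ c ν⁻⁴` for `ν ≥ 1`, by monotonicity).  With x2's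
`hkRed_ray_of_laplace` this is a second proof of the cut `hkRed_ray` (the first is `KMShapeGlue.hkRed_ray_of_plane`).

Imports: Mathlib and the Tier-4 modules named above, by name (including x2's `Line3/KMLaplace`).  `#print axioms` of
every theorem = `[propext, Classical.choice, Quot.sound]`.  No printed input is consumed.  Nothing here asserts anything
about the truth of (P); HC_CM is NOT proved by anyone in this repository.
-/

set_option autoImplicit false

noncomputable section

namespace Summit.Ventures.HodgeRepro.Tier4.Line3

open Summit.Ventures.HodgeRepro.Tier4
open Matrix MeasureTheory
open scoped ComplexConjugate

namespace T4Data

variable (X : T4Data)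

/-- x2's displayed **upper Laplace bound** is a theorem: `KMLaplaceUpper xm C 6` for some `C ≥ 0`. -/
theorem exists_kmLaplaceUpper (xm : X.Tuple) (h02 : xm 2 = xm 0) (h13 : xm 3 = xm 1)
    (hab : X.ballCoord (xm 0) 0 * X.ballCoord (xm 1) 1 - X.ballCoord (xm 0) 1 * X.ballCoord (xm 1) 0 ≠ 0)
    (hpos : ∀ u v : ℂ, (u ≠ 0 ∨ v ≠ 0) →
      0 < (star (u • X.ballCoord (xm 0) + v • X.ballCoord (xm 1)) ⬝ᵥ
        (J *ᵥ (u • X.ballCoord (xm 0) + v • X.ballCoord (xm 1)))).re) :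
    ∃ C : ℝ, 0 ≤ C ∧ X.KMLaplaceUpper xm C 6 := by
  have hzs := commonZero_mem_ball (X.ballCoord (xm 0)) (X.ballCoord (xm 1)) hab hpos
  have hW0 : wedge (kmLin (X.ballCoord (xm 0)) (commonZero (X.ballCoord (xm 0)) (X.ballCoord (xm 1))))
      (kmLin (X.ballCoord (xm 1)) (commonZero (X.ballCoord (xm 0)) (X.ballCoord (xm 1)))) ≠ 0 :=
    wedge_kmLin_ne_zero_of_jOrth hab (jform_lift3_commonZero_left _ _ hab) (jform_lift3_commonZero_right _ _ hab)
  have heq : ∀ α β : ℝ, X.kmDilInt xm α β = shapeInt (X.ballCoord (xm 0)) (X.ballCoord (xm 1))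
      (fun z => wedge (kmLin (X.ballCoord (xm 0)) z) (kmLin (X.ballCoord (xm 1)) z)) α β :=
    fun α β => funext fun z => X.kmDilInt_eq_shapeInt xm h02 h13 hpos α β z
  obtain ⟨A₁, A₂, hA₁, hA₂, hup⟩ := exists_upper_bound (X.ballCoord (xm 0)) (X.ballCoord (xm 1)) hab hpos
    (fun z => wedge (kmLin (X.ballCoord (xm 0)) z) (kmLin (X.ballCoord (xm 1)) z))
    (continuousOn_wedge_kmLin _ _) (norm_nonneg _) (by positivity)
    (fun z hz => norm_wedge_kmLin_le _ _ hz) hW0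
  refine ⟨64 * (A₁ + A₂), by positivity, fun α β hα hβ => ?_, fun μ hμ => ?_⟩
  · rw [heq]
    exact integrableOn_shapeInt (X.ballCoord (xm 0)) (X.ballCoord (xm 1)) hab hpos _
      (continuousOn_wedge_kmLin _ _) (norm_nonneg _) (by positivity) (fun z hz => norm_wedge_kmLin_le _ _ hz) hW0
      hα hβ
  · unfold kmJ
    rw [heq]
    have hs : 0 < μ / 2 := by positivity
    have h := hup (μ / 2) hs
    rw [show 2 * (μ / 2) = μ by ring] at h
    have e4 : ((μ / 2) ^ 4)⁻¹ = 16 * μ ^ (-4 : ℝ) := by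
      rw [Real.rpow_neg hμ.le, show ((4 : ℝ)) = ((4 : ℕ) : ℝ) by norm_num, Real.rpow_natCast]
      field_simp
      norm_num
    have e6 : ((μ / 2) ^ 6)⁻¹ = 64 * μ ^ (-(6 : ℝ)) := by
      rw [Real.rpow_neg hμ.le, show ((6 : ℝ)) = ((6 : ℕ) : ℝ) by norm_num, Real.rpow_natCast]
      field_simp
      norm_num
    rw [e4, e6] at h
    have h4 : 0 ≤ μ ^ (-4 : ℝ) := Real.rpow_nonneg hμ.le _
    have h6 : 0 ≤ μ ^ (-(6 : ℝ)) := Real.rpow_nonneg hμ.le _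
    nlinarith [mul_nonneg hA₁ h4, mul_nonneg hA₂ h6, mul_nonneg hA₁ h6, mul_nonneg hA₂ h4]

/-- x2's displayed **lower Laplace bound** is a theorem: `KMLaplaceLower xm c` for some `c > 0`. -/
theorem exists_kmLaplaceLower (xm : X.Tuple) (h02 : xm 2 = xm 0) (h13 : xm 3 = xm 1)
    (hab : X.ballCoord (xm 0) 0 * X.ballCoord (xm 1) 1 - X.ballCoord (xm 0) 1 * X.ballCoord (xm 1) 0 ≠ 0)
    (hpos : ∀ u v : ℂ, (u ≠ 0 ∨ v ≠ 0) →
      0 < (star (u • X.ballCoord (xm 0) + v • X.ballCoord (xm 1)) ⬝ᵥ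
        (J *ᵥ (u • X.ballCoord (xm 0) + v • X.ballCoord (xm 1)))).re) :
    ∃ c : ℝ, 0 < c ∧ X.KMLaplaceLower xm c := by
  have hzs := commonZero_mem_ball (X.ballCoord (xm 0)) (X.ballCoord (xm 1)) hab hpos
  have hW0 : wedge (kmLin (X.ballCoord (xm 0)) (commonZero (X.ballCoord (xm 0)) (X.ballCoord (xm 1))))
      (kmLin (X.ballCoord (xm 1)) (commonZero (X.ballCoord (xm 0)) (X.ballCoord (xm 1)))) ≠ 0 :=
    wedge_kmLin_ne_zero_of_jOrth hab (jform_lift3_commonZero_left _ _ hab) (jform_lift3_commonZero_right _ _ hab)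
  have heq : ∀ α β : ℝ, X.kmDilInt xm α β = shapeInt (X.ballCoord (xm 0)) (X.ballCoord (xm 1))
      (fun z => wedge (kmLin (X.ballCoord (xm 0)) z) (kmLin (X.ballCoord (xm 1)) z)) α β :=
    fun α β => funext fun z => X.kmDilInt_eq_shapeInt xm h02 h13 hpos α β z
  obtain ⟨c, hc, hlow⟩ := exists_lower_bound (X.ballCoord (xm 0)) (X.ballCoord (xm 1)) hab hpos
    (fun z => wedge (kmLin (X.ballCoord (xm 0)) z) (kmLin (X.ballCoord (xm 1)) z))
    (continuousOn_wedge_kmLin _ _) (norm_nonneg _) (by positivity)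
    (fun z hz => norm_wedge_kmLin_le _ _ hz) hW0
  -- `Φ(ν/2) = J(ν)` and `c (ν/2)⁻⁴ = 16 c ν⁻⁴ ≥ c ν⁻⁴`; the lower bound needs `ν/2 ≥ 1`, so use `ν ≥ 2` via `Φ(ν/2) ≥ Φ(ν)`
  refine ⟨c, hc, fun ν hν _ => ?_⟩
  unfold kmJ
  rw [heq]
  -- monotonicity: `Φ` is antitone, so for `ν ≥ 1`: `J(ν) = Φ(ν/2) ≥ Φ(ν)`, and `Φ(ν) ≥ c ν⁻⁴`
  have h1 := hlow ν hν
  have hνpos : 0 < ν := by linarith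
  have hmono : ∫ z in ball, shapeInt (X.ballCoord (xm 0)) (X.ballCoord (xm 1))
      (fun z => wedge (kmLin (X.ballCoord (xm 0)) z) (kmLin (X.ballCoord (xm 1)) z)) (2 * ν) (2 * ν) z ≤
      ∫ z in ball, shapeInt (X.ballCoord (xm 0)) (X.ballCoord (xm 1))
      (fun z => wedge (kmLin (X.ballCoord (xm 0)) z) (kmLin (X.ballCoord (xm 1)) z)) ν ν z := by
    refine setIntegral_mono_on ?_ ?_ isOpen_ball.measurableSet fun z hz => ?_
    · exact integrableOn_shapeInt _ _ hab hpos _ (continuousOn_wedge_kmLin _ _) (norm_nonneg _) (by positivity)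
        (fun z hz => norm_wedge_kmLin_le _ _ hz) hW0 (by positivity) (by positivity)
    · exact integrableOn_shapeInt _ _ hab hpos _ (continuousOn_wedge_kmLin _ _) (norm_nonneg _) (by positivity)
        (fun z hz => norm_wedge_kmLin_le _ _ hz) hW0 hνpos hνpos
    · exact shapeInt_anti _ _ _ (by linarith) (by linarith) hz
  have e4 : ν ^ (-4 : ℝ) = (ν ^ 4)⁻¹ := by
    rw [Real.rpow_neg hνpos.le, show ((4 : ℝ)) = ((4 : ℕ) : ℝ) by norm_num, Real.rpow_natCast]
  rw [e4]
  exact h1.trans hmono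

end T4Data

end Summit.Ventures.HodgeRepro.Tier4.Line3

end
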